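import Summits.QuantumAdvantage.QuantumAdvantage.Theorems.LinnikCubicClassGroupsDegreeOnePrimesEscapeShortIntervalZeroSum
import Summits.QuantumAdvantage.QuantumAdvantage.Theorems.LinnikCubicClassGroupsDegreeOnePrimesEscapeShortIntervalSmoothed
import Summits.QuantumAdvantage.QuantumAdvantage.Theorems.LinnikCubicClassGroupsDegreeOnePrimesEscapeShortIntervalInputs
import Summits.QuantumAdvantage.QuantumAdvantage.Theorems.LinnikCubicClassGroupsDegreeOnePrimesEscapeShortIntervalBookkeeping
import Summits.QuantumAdvantage.QuantumAdvantage.Theorems.LinnikCubicClassGroupsDegreeOnePrimesEscapeClassPNTFamilyDensity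
import Summits.QuantumAdvantage.QuantumAdvantage.Theorems.LinnikCubicClassGroupsDegreeOnePrimesEscapeResidueAllFields
import HarnessLib

/-!
# Prime ideals of a class in short intervals, IIIc: the error of one window

Topic `Summits/QuantumAdvantage/QuantumAdvantage/Theorems`, cell B2b-1 (linnik-cubic), PART A (gen 5);
helper for the crux `DegreeOnePrimesEscape` (stmt-QuantumAdvantage-11543) of route
`LinnikCubicClassGroups`.  HONEST FRAMING: the value of this file is a THEOREM (kernel-checked lemma)
— NOT summit progress.

`window_error_le`: for a number field `K` of degree `n > 1` with the log-free density bound in `Q`-form,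
clause (1) of the Landau–Page package with constant `c` and NO zero of the family on the exceptional
segment, and for the window weight `g = windowTest lo hi (η/4)` with `log x ≤ lo < hi ≤ log x + η`
(`η = log(1 + h/x)`), the smoothed class sum satisfies `|h_K ψ̃_C(g) − Re F(−1)| ≤ x η/8` once
`x ≥ Q^{a₀}` in the sense of the size hypotheses (`a log Q ≤ θ log x`, `2 ≤ θ log x`, `x^{−θ/8} ≤ 2η`,
absorption).  It combines files I (zero sum), II (smoothed explicit formula), III (inputs) and IIIb
(real bookkeeping).  Also two exponential inequalities for the main terms of the two windows.
-/

noncomputable section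

open Complex Real MeasureTheory Set Filter Topology
open scoped NumberField nonZeroDivisors

namespace Summit.QuantumAdvantage.QuantumAdvantage.Theorems.DegreeOnePrimesEscape

open Literature.NumberTheory.LFunctions Literature.NumberTheory.LFunctions.NumberField
  Literature.NumberTheory.LFunctions.EntireEF Literature.NumberTheory.LFunctions.WindowWeight
  Literature.NumberTheory.LFunctions.AbelianDensity

variable {K : Type} [Field K] [NumberField K]

/-! ### The error of one window -/

set_option maxHeartbeats 1600000 in
/-- **The error of one window.**  Let `K` have degree `n > 1`, let the log-free density bound in `Q`-form
hold with constants `b, D, a`, clause (1) of the Landau–Page package with `c > 0` and NO zero of the family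
on the exceptional segment `excRegion c K`; let `0 < θ ≤ 1/8`, `θ b ≤ 1/8`, `2eD e^{−c/(6θ)} ≤ 1/64`;
let `x ≥ Q` with `a log Q ≤ θ log x`, `2 ≤ θ log x`, `0 < η ≤ log 2`, `x^{−θ/8} ≤ 2η`, and the absorption
inequality `C_J Q⁷ (log x + 1) x^{−θ/4} ≤ 1/32`.  Then for every window `log x ≤ lo < hi ≤ log x + η` and
every class `C`, with `g = windowTest lo hi (η/4)` and `F` its Laplace transform:
`|h_K ψ̃_C(g) − Re F(−1)| ≤ x η / 8`. -/
theorem window_error_le {n : ℕ} (hn : 1 < n) (hKn : Module.finrank ℚ K = n)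
    {b D a : ℝ} (hb : 0 < b) (hD : 0 < D) (ha : 1 ≤ a)
    (hdens : ∀ (T : ℝ), 1 ≤ T → ∀ u : AddChar (Additive (ClassGroup (𝓞 K))) ℂ → Finset ℂ,
        (∀ ψ, ∀ ρ ∈ u ψ, famF K ψ ρ = 0 ∧ 1 / 4 ≤ ρ.re ∧ ρ.re < 1 ∧ |ρ.im| ≤ T) →
        ∀ α : ℝ, α ≤ 1 →
          ∑ ψ, ∑ ρ ∈ u ψ with α ≤ ρ.re, (famMult K ψ ρ : ℝ) ≤
            D * Real.exp (b * (a * Real.log (ThornerZaman.condQn K) + Real.log (T + 4))) ^ (1 - α))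
    {c : ℝ} (hc : 0 < c)
    (hpack : ∀ (χ : ClassGroup (𝓞 K) →* ℂˣ) (ρ : ℂ),
      (((χ = 1 → dedekindZeta₁ K ρ = 0) ∧ (χ ≠ 1 → classGroupLFunction₀ K χ ρ = 0)) ∧
        1 - c / (Real.log ((NumberField.discr K).natAbs : ℝ) + Real.log (|ρ.im| + 4)) < ρ.re) →
        ρ.im = 0 ∧ χ * χ = 1)
    (hnoexc : ∀ (ψ : AddChar (Additive (ClassGroup (𝓞 K))) ℂ) (ρ : ℂ), famF K ψ ρ = 0 → 0 < ρ.re →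
      ρ.re < 1 → ¬ excRegion c K ρ)
    {M : ℝ} (hM1 : 1 ≤ M)
    (hM : ∀ y : ℝ, |iteratedDeriv 1 Real.smoothTransition y| ≤ M ∧ |iteratedDeriv 2 Real.smoothTransition y| ≤ M)
    {A_L : ℝ} (hAL : 0 < A_L)
    (hA : ∀ (K' : Type) [Field K'] [NumberField K'] (χ : ClassGroup (𝓞 K') →* ℂˣ) (t : ℝ),
      ‖logDeriv (classGroupLFunction K' χ) (-1 / 2 + t * I)‖ ≤
        A_L * (Module.finrank ℚ K' + 1) * (Real.log ((NumberField.discr K').natAbs : ℝ) + Real.log (|t| + 4)))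
    {θ : ℝ} (hθ0 : 0 < θ) (hθb : θ * b ≤ 1 / 8) (hθ1 : θ ≤ 1 / 8)
    (hθflat : 2 * Real.exp 1 * D * Real.exp (-(c / (6 * θ))) ≤ 1 / 64)
    {x η : ℝ} (hQx : ThornerZaman.condQn K ≤ x)
    (haθ : a * Real.log (ThornerZaman.condQn K) ≤ θ * Real.log x) (h2θ : 2 ≤ θ * Real.log x)
    (hη0 : 0 < η) (hη1 : η ≤ Real.log 2) (hηx : Real.exp (-(θ / 8) * Real.log x) ≤ 2 * η)
    (habs : (338 * (512 * ((n : ℝ) + 1)) + 96 * M * (512 * ((n : ℝ) + 1)) * (4 * tailConst₁ + tailConst₂) + 108 +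
        640 * leftLineConst * A_L * M) * ThornerZaman.condQn K ^ (7 : ℕ) * (Real.log x + 1) *
        Real.exp (-(θ / 4) * Real.log x) ≤ 1 / 32)
    {lo hi : ℝ} (hlo : Real.log x ≤ lo) (hlohi : lo < hi) (hhi : hi ≤ Real.log x + η)
    (C : ClassGroup (𝓞 K)) :
    |(NumberField.classNumber K : ℝ) * smoothedPsiClass K C (windowTest lo hi (η / 4)) -
        (fordLaplace (windowTest lo hi (η / 4)) (-1)).re| ≤ x * η / 8 := by
  classical
  obtain ⟨hc₁16, hc₂0⟩ := tailConst_nonneg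
  have hlC := leftLineConst_nonneg
  have hK : 1 < Module.finrank ℚ K := by rw [hKn]; exact hn
  have hQ12 : (12 : ℝ) ≤ ThornerZaman.condQn K := ThornerZaman.twelve_le_condQn (K := K) hK
  have hx0 : 0 < x := by linarith
  have hxexp : Real.exp (Real.log x) = x := Real.exp_log hx0
  -- `L ≥ 16`, hence `ε = η/4 < lo`
  have hlog2 : Real.log 2 < 0.6931471808 := Real.log_two_lt_d9
  have hθL8 : θ * Real.log x ≤ Real.log x / 8 := by
    have hL0' : 0 ≤ Real.log x := Real.log_nonneg (by linarith)
    have := mul_le_mul_of_nonneg_right hθ1 hL0'; linarith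
  set ε : ℝ := η / 4 with hε
  have hε0 : 0 < ε := by positivity
  have hεlo : ε < lo := by rw [hε]; linarith
  set ℓ : ℝ := hi - lo + 2 * ε with hℓ
  have hℓ0 : 0 < ℓ := by rw [hℓ]; linarith
  set LX : ℝ := hi + ε with hLX
  set X : ℝ := Real.exp LX with hX
  set T₁ : ℝ := Real.exp (θ * LX) with hT₁
  have hLX0 : 0 ≤ LX := by
    have : 0 ≤ Real.log x := Real.log_nonneg (by linarith)
    rw [hLX]; linarith
  have hT₁1 : 1 ≤ T₁ := Real.one_le_exp (mul_nonneg hθ0.le hLX0)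
  -- the range condition
  have hrange : Real.exp (b * (a * Real.log (ThornerZaman.condQn K) + Real.log (T₁ + 4))) ≤
      Real.exp (hi + ε) ^ ((1 : ℝ) / 2) :=
    window_range hb hθ0 hθb hθ1 haθ h2θ hη0 hlo hlohi hε hLX hT₁
  -- sizes of the field data
  have hnQ : (Module.finrank ℚ K : ℝ) ≤ ThornerZaman.condQn K := ThornerZaman.finrank_le_condQn (K := K)
  have hhK : (NumberField.classNumber K : ℝ) ≤ ThornerZaman.condQn K ^ (4 : ℕ) :=
    ThornerZaman.classNumber_le_condQn_pow (K := K) hK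
  have hAK4 : Real.log ((NumberField.discr K).natAbs : ℝ) + 3 * Module.finrank ℚ K ≤
      4 * ThornerZaman.condQn K := windowConst_le_condQn K
  have hlogd0 : 0 ≤ Real.log ((NumberField.discr K).natAbs : ℝ) := Real.log_natCast_nonneg _
  -- the two-sided smoothed estimate with `Exc = ∅`
  have hsm := norm_classNumber_mul_smoothedPsiClass_window_sub_le (K := K) (c := c) hε0 hεlo hlohi C
    (fun _ ↦ (∅ : Finset ℂ)) (fun ψ ρ hρ ↦ absurd hρ (Finset.notMem_empty ρ))
    (fun ψ ρ h0 hρ0 hρ1 hexc ↦ absurd hexc (hnoexc ψ ρ h0 hρ0 hρ1))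
    (fun u hu ↦ fam_zeroSum_window_le_local hb hD ha hK hdens hc hpack hM hε0 hεlo hlohi hT₁1 hrange u hu)
    (M₀ := 64 * ThornerZaman.condQn K * ℓ)
    (fun ψ ↦ ?_)
    (norm_dzEFRemainder_windowTest_zero_le hAL hA hM hε0 hεlo hlohi)
    (fun ψ hψ ↦ norm_cgEFRemainder_windowTest_zero_le hAL hA (toHomUnits_ne_one hψ) hM hε0 hεlo hlohi)
  swap
  · -- the trivial-zero multiplicities: `m_ψ(0) ≤ 8(log|d_K| + 6n + 3) ≤ 64 Q`
    have hm : (famMult K ψ 0 : ℝ) ≤ 64 * ThornerZaman.condQn K := by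
      by_cases hψ : ψ = 0
      · subst hψ
        rw [famMult, famF_zero]
        refine (analyticOrderNatAt_dedekindZeta₁_zero_le (K := K)).trans ?_
        linarith
      · rw [famMult, famF_of_ne hψ]
        refine (analyticOrderNatAt_classGroupLFunction₀_zero_le (toHomUnits_ne_one hψ)).trans ?_
        linarith
    have := mul_le_mul_of_nonneg_right hm hℓ0.le
    linarith
  simp only [Finset.sum_empty, mul_zero, Finset.sum_const_zero, add_zero] at hsm
  -- the real part
  have hre : ((NumberField.classNumber K : ℂ) * (smoothedPsiClass K C (windowTest lo hi ε) : ℂ) -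
      fordLaplace (windowTest lo hi ε) (-1)).re =
      (NumberField.classNumber K : ℝ) * smoothedPsiClass K C (windowTest lo hi ε) -
        (fordLaplace (windowTest lo hi ε) (-1)).re := by
    rw [Complex.sub_re, ← Complex.ofReal_natCast, ← Complex.ofReal_mul, Complex.ofReal_re]
  rw [← hre]
  refine (Complex.abs_re_le_norm _).trans (hsm.trans ?_)
  rw [← hxexp]
  exact window_bookkeeping (W₀ := 512 * ((Module.finrank ℚ K : ℝ) + 1))
    (AK := Real.log ((NumberField.discr K).natAbs : ℝ) + 3 * Module.finrank ℚ K)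
    hQ12 hM1 hAL (by positivity) hlC hc₁16 hc₂0 hD hc ha hhK (Nat.cast_nonneg _) rfl hAK4 hlogd0 hnQ
    (Nat.cast_nonneg _) hθ0 hθ1 hθflat haθ h2θ hη0 hη1 hηx (by rw [hKn]; exact habs) hlo hlohi hhi
    hε hℓ hLX hX hT₁


/-! ### Two exponential inequalities for the main terms -/

/-- `η/2 ≤ e^{3η/4} − e^{η/4}` for `η ≥ 0`. [folklore] -/
theorem half_eta_le_exp_sub {η : ℝ} (hη : 0 ≤ η) : η / 2 ≤ Real.exp (3 * η / 4) - Real.exp (η / 4) := by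
  have h2 : Real.exp (3 * η / 4) = Real.exp (η / 4) * Real.exp (η / 2) := by
    rw [← Real.exp_add]; congr 1; ring
  have h3 : η / 2 + 1 ≤ Real.exp (η / 2) := Real.add_one_le_exp _
  have h4 : 1 ≤ Real.exp (η / 4) := Real.one_le_exp (by positivity)
  rw [h2]; nlinarith [Real.exp_pos (η / 2)]

/-- `e^{5η/4} − e^{−η/4} ≤ (15/4) η` for `0 ≤ η ≤ 0.7`. [folklore] -/
theorem exp_sub_exp_le_eta {η : ℝ} (hη : 0 ≤ η) (hη1 : η ≤ 0.7) :
    Real.exp (5 * η / 4) - Real.exp (-(η / 4)) ≤ 15 / 4 * η := by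
  have he1 : Real.exp 1 < 2.7182818286 := Real.exp_one_lt_d9
  have h3 : Real.exp (5 * η / 4) ≤ Real.exp 1 := Real.exp_le_exp.2 (by linarith)
  have h4 : Real.exp (5 * η / 4) - 1 ≤ 5 * η / 4 * Real.exp (5 * η / 4) := by
    have h := Real.add_one_le_exp (-(5 * η / 4))
    have hm : Real.exp (-(5 * η / 4)) * Real.exp (5 * η / 4) = 1 := by rw [← Real.exp_add]; simp
    nlinarith [Real.exp_pos (5 * η / 4), Real.exp_pos (-(5 * η / 4))]
  have h5 : 1 - Real.exp (-(η / 4)) ≤ η / 4 := by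
    have := Real.add_one_le_exp (-(η / 4)); linarith
  nlinarith

end Summit.QuantumAdvantage.QuantumAdvantage.Theorems.DegreeOnePrimesEscape

end
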